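import Mathlib
import Summits.NavierStokesRegularity.NavierStokesRegularity.Theorems.StretchingWellBindingEnstrophyQuarterLawSieve
import Summits.NavierStokesRegularity.NavierStokesRegularity.Theorems.StretchingWellBindingEnstrophyQuarterLawSmoothingEnvelope
import Summits.NavierStokesRegularity.NavierStokesRegularity.Theorems.StretchingWellBindingEnstrophyQuarterLawFarFieldEnstrophy
import Summits.NavierStokesRegularity.NavierStokesRegularity.Theorems.StretchingWellBindingEnstrophyQuarterLawWindowToSlice
import Summits.NavierStokesRegularity.NavierStokesRegularity.Theses.StretchingWellBinding
import Summits.NavierStokesRegularity.NavierStokesRegularity.Theses.TypeILiouville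
import Summits.NavierStokesRegularity.NavierStokesRegularity.Theses.HalfHolderEnergy
import HarnessLib

/-!
# Shelf crux `EnstrophyQuarterLaw` (stmt-NavierStokesRegularity-1574), line «sparse_sieve»:
# the line ASSEMBLED over its open stubs (net statement as tree theorems)

Theorems helper file (seat ns-hhe-c1 g2; `--supports` the shelf crux). With the three provable / known
stubs of the skeleton of record `Cruxes/EnstrophyQuarterLaw/Lines/sparse_sieve.lean` now tree theorems
(`stub_farFieldEnstrophy` p607039, `stub_sieve` p612439, `stub_smoothingEnvelope` p614511) and the
converter `stub_windowToSlice` (p608800), the NET STATEMENT of the line is recorded here BY NAME, its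
hypotheses being exactly the line's OPEN stubs:

* `windowLaw_of_uniformLocalTypeI_of_uniformSparseness` — for ONE maximal classical Leray–Hopf solution
  from a rapidly decaying datum: uniform local Type I (CKN `A`, `E` at scales `≤ r₀`) ∧ uniform
  sparseness of `L³`-concentration at every threshold ⇒ the window quarter law
  `∫_a^b ∫ |curl u|² ≤ K √(b − a)` (the frontier lemma «uniformly sparse CKN-Type-I first blow-ups
  have ½-Hölder kinetic energy» of the line card, now unconditional);
* `energyHalfHolder_of_uniformLocalTypeI_of_uniformSparseness` — hence
  `(∀ solutions, S1) → (∀ solutions, S2) → Theses.HalfHolderEnergy.EnergyHalfHolder` (item 25161 BY NAME,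
  CONDITIONAL on the two open velocity-side hypotheses; nothing about 25161 itself is claimed);
* `enstrophyQuarterLaw_of_noTypeII_of_uniformLocalTypeI_of_uniformSparseness` — and with the sibling
  crux `TypeIliouvilleNoTypeII` (0056) the shelf crux BY NAME:
  `NoTypeII → (∀ S1) → (∀ S2) → Theses.StretchingWellBinding.EnstrophyQuarterLaw`
  (= the skeleton theorem `EnstrophyQuarterLaw_of` with its open stubs as hypotheses).

HONEST FRAMING: conditional assemblies; the hypotheses S1 (`UniformLocalTypeI`, CKN-Type-I), S2
(`UniformSparseness`) and NoTypeII are OPEN (XL) and are NOT claimed; no summit statement is proved;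
EnstrophyQuarterLaw (1574) and EnergyHalfHolder (25161) remain OPEN.
-/

noncomputable section

-- the summit and its single sub-problem share the name (CONVENTIONS §1), as in every Theorems file
set_option linter.dupNamespace false

namespace Summit.NavierStokesRegularity.NavierStokesRegularity.Theorems.EnstrophyQuarterLaw.SparseSieve

open MeasureTheory Set Metric
open Literature.Analysis Literature.Analysis.FluidPDE
open scoped ENNReal

/-- **The sparse sieve line for one solution**: uniform local Type I (S1) ∧ uniform sparseness (S2)
⇒ the window quarter law, unconditionally (S3 smoothing envelope, S4 far field and S5 the sieve are
tree theorems). [folklore] -/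
theorem windowLaw_of_uniformLocalTypeI_of_uniformSparseness (ν T : ℝ) (hν : 0 < ν) (hT : 0 < T)
    (u : ℝ → EuclideanSpace ℝ (Fin 3) → EuclideanSpace ℝ (Fin 3))
    (p : ℝ → EuclideanSpace ℝ (Fin 3) → ℝ)
    (hmax : IsMaximalSmoothSolution ν 0 u p T) (hLH : IsLerayHopfOn T ν 0 (u 0) u)
    (hdec : HasRapidSpatialDecay (u 0))
    (hTI : ∃ M r₀ : ℝ, 0 < M ∧ 0 < r₀ ∧
      (∀ s ∈ Set.Ico 0 T, ∀ (x : EuclideanSpace ℝ (Fin 3)), ∀ R ∈ Set.Ioc 0 r₀,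
        ∫⁻ y in Metric.ball x R, ‖u s y‖ₑ ^ 2 ≤ ENNReal.ofReal (M * R)) ∧
      (∀ b ∈ Set.Ioc 0 T, ∀ (x : EuclideanSpace ℝ (Fin 3)), ∀ R ∈ Set.Ioc 0 r₀, R ^ 2 ≤ b →
        ∫⁻ t in Set.Ioo (b - R ^ 2) b, ∫⁻ y in Metric.ball x R, ‖fderiv ℝ (u t) y‖ₑ ^ 2 ≤
          ENNReal.ofReal (M * R)))
    (hSp : ∃ r₀ : ℝ, 0 < r₀ ∧ ∀ ε₀ : ℝ, 0 < ε₀ → ∃ N₀ : ℕ,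
      ∀ t ∈ Set.Ico 0 T, ∀ r ∈ Set.Ioc 0 r₀, ∀ F : Finset (EuclideanSpace ℝ (Fin 3)),
        (∀ x ∈ F, ∀ y ∈ F, x ≠ y → 4 * r ≤ dist x y) →
        (∀ x ∈ F, ENNReal.ofReal (ε₀ ^ 3) ≤ ∫⁻ y in Metric.ball x (2 * r), ‖u t y‖ₑ ^ 3) →
        F.card ≤ N₀) :
    ∃ K : ℝ, ∀ a b : ℝ, 0 ≤ a → a ≤ b → b ≤ T →
      ∫⁻ t in Set.Ioo a b, ∫⁻ x, ‖curl (u t) x‖ₑ ^ 2 ≤ ENNReal.ofReal (K * Real.sqrt (b - a)) :=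
  stub_sieve ν T hν hT u p hmax hLH hdec hTI hSp
    (stub_smoothingEnvelope ν T hν hT u p hmax hLH hdec)
    (stub_farFieldEnstrophy ν T hν hT u p hmax hLH hdec)

/-- **Item `EnergyHalfHolder` (25161) BY NAME, conditionally on the two open velocity-side
hypotheses**: if every maximal classical Leray–Hopf solution from a rapidly decaying datum has
uniform local Type I (S1) and uniform sparseness (S2), the window quarter law `EnergyHalfHolder`
holds. The hypotheses are OPEN; nothing unconditional about 25161 is claimed. [folklore] -/
theorem energyHalfHolder_of_uniformLocalTypeI_of_uniformSparseness
    (h1 : ∀ (ν T : ℝ), 0 < ν → 0 < T →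
      ∀ (u : ℝ → EuclideanSpace ℝ (Fin 3) → EuclideanSpace ℝ (Fin 3))
        (p : ℝ → EuclideanSpace ℝ (Fin 3) → ℝ),
      IsMaximalSmoothSolution ν 0 u p T → IsLerayHopfOn T ν 0 (u 0) u →
      HasRapidSpatialDecay (u 0) →
      ∃ M r₀ : ℝ, 0 < M ∧ 0 < r₀ ∧
        (∀ s ∈ Set.Ico 0 T, ∀ (x : EuclideanSpace ℝ (Fin 3)), ∀ R ∈ Set.Ioc 0 r₀,
          ∫⁻ y in Metric.ball x R, ‖u s y‖ₑ ^ 2 ≤ ENNReal.ofReal (M * R)) ∧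
        (∀ b ∈ Set.Ioc 0 T, ∀ (x : EuclideanSpace ℝ (Fin 3)), ∀ R ∈ Set.Ioc 0 r₀, R ^ 2 ≤ b →
          ∫⁻ t in Set.Ioo (b - R ^ 2) b, ∫⁻ y in Metric.ball x R, ‖fderiv ℝ (u t) y‖ₑ ^ 2 ≤
            ENNReal.ofReal (M * R)))
    (h2 : ∀ (ν T : ℝ), 0 < ν → 0 < T →
      ∀ (u : ℝ → EuclideanSpace ℝ (Fin 3) → EuclideanSpace ℝ (Fin 3))
        (p : ℝ → EuclideanSpace ℝ (Fin 3) → ℝ),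
      IsMaximalSmoothSolution ν 0 u p T → IsLerayHopfOn T ν 0 (u 0) u →
      HasRapidSpatialDecay (u 0) →
      ∃ r₀ : ℝ, 0 < r₀ ∧ ∀ ε₀ : ℝ, 0 < ε₀ → ∃ N₀ : ℕ,
        ∀ t ∈ Set.Ico 0 T, ∀ r ∈ Set.Ioc 0 r₀, ∀ F : Finset (EuclideanSpace ℝ (Fin 3)),
          (∀ x ∈ F, ∀ y ∈ F, x ≠ y → 4 * r ≤ dist x y) →
          (∀ x ∈ F, ENNReal.ofReal (ε₀ ^ 3) ≤ ∫⁻ y in Metric.ball x (2 * r), ‖u t y‖ₑ ^ 3) →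
          F.card ≤ N₀) :
    Theses.HalfHolderEnergy.EnergyHalfHolder := by
  intro ν T hν hT u p hmax hLH hdec
  exact windowLaw_of_uniformLocalTypeI_of_uniformSparseness ν T hν hT u p hmax hLH hdec
    (h1 ν T hν hT u p hmax hLH hdec) (h2 ν T hν hT u p hmax hLH hdec)

/-- **The shelf crux `EnstrophyQuarterLaw` (1574) BY NAME from the open stubs of line «sparse_sieve»**:
sup-rate Type I (`TypeIliouvilleNoTypeII`, item 0056) + uniform local Type I (S1) + uniform
sparseness (S2) for every maximal classical Leray–Hopf solution ⇒ the slice quarter law (composition of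
`energyHalfHolder_of_uniformLocalTypeI_of_uniformSparseness` with the converter
`enstrophyQuarterLaw_of_noTypeII_of_energyHalfHolder`, p608800). All three hypotheses are OPEN;
nothing unconditional is claimed. [folklore] -/
theorem enstrophyQuarterLaw_of_noTypeII_of_uniformLocalTypeI_of_uniformSparseness
    (hN : Theses.TypeILiouville.TypeIliouvilleNoTypeII)
    (h1 : ∀ (ν T : ℝ), 0 < ν → 0 < T →
      ∀ (u : ℝ → EuclideanSpace ℝ (Fin 3) → EuclideanSpace ℝ (Fin 3))
        (p : ℝ → EuclideanSpace ℝ (Fin 3) → ℝ),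
      IsMaximalSmoothSolution ν 0 u p T → IsLerayHopfOn T ν 0 (u 0) u →
      HasRapidSpatialDecay (u 0) →
      ∃ M r₀ : ℝ, 0 < M ∧ 0 < r₀ ∧
        (∀ s ∈ Set.Ico 0 T, ∀ (x : EuclideanSpace ℝ (Fin 3)), ∀ R ∈ Set.Ioc 0 r₀,
          ∫⁻ y in Metric.ball x R, ‖u s y‖ₑ ^ 2 ≤ ENNReal.ofReal (M * R)) ∧
        (∀ b ∈ Set.Ioc 0 T, ∀ (x : EuclideanSpace ℝ (Fin 3)), ∀ R ∈ Set.Ioc 0 r₀, R ^ 2 ≤ b →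
          ∫⁻ t in Set.Ioo (b - R ^ 2) b, ∫⁻ y in Metric.ball x R, ‖fderiv ℝ (u t) y‖ₑ ^ 2 ≤
            ENNReal.ofReal (M * R)))
    (h2 : ∀ (ν T : ℝ), 0 < ν → 0 < T →
      ∀ (u : ℝ → EuclideanSpace ℝ (Fin 3) → EuclideanSpace ℝ (Fin 3))
        (p : ℝ → EuclideanSpace ℝ (Fin 3) → ℝ),
      IsMaximalSmoothSolution ν 0 u p T → IsLerayHopfOn T ν 0 (u 0) u →
      HasRapidSpatialDecay (u 0) →
      ∃ r₀ : ℝ, 0 < r₀ ∧ ∀ ε₀ : ℝ, 0 < ε₀ → ∃ N₀ : ℕ,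
        ∀ t ∈ Set.Ico 0 T, ∀ r ∈ Set.Ioc 0 r₀, ∀ F : Finset (EuclideanSpace ℝ (Fin 3)),
          (∀ x ∈ F, ∀ y ∈ F, x ≠ y → 4 * r ≤ dist x y) →
          (∀ x ∈ F, ENNReal.ofReal (ε₀ ^ 3) ≤ ∫⁻ y in Metric.ball x (2 * r), ‖u t y‖ₑ ^ 3) →
          F.card ≤ N₀) :
    Theses.StretchingWellBinding.EnstrophyQuarterLaw :=
  enstrophyQuarterLaw_of_noTypeII_of_energyHalfHolder hN
    (energyHalfHolder_of_uniformLocalTypeI_of_uniformSparseness h1 h2)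

end Summit.NavierStokesRegularity.NavierStokesRegularity.Theorems.EnstrophyQuarterLaw.SparseSieve

end
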